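import Literature.AnabelianGeometry.AbsoluteAnabelian.MonoidKummerMapsSub
import Literature.AnabelianGeometry.AbsoluteAnabelian.AbsTopIII.MLFGaloisModelCategories
import Literature.AnabelianGeometry.AbsoluteAnabelian.AutPairCenterFreeProofs

/-!
# [AbsTopIII] Prop 3.2 (iv): «the categories `𝒯𝒢^hyp`, `𝒯𝒢^sB` [underlined] … are id-rigid» at the model groupoid
# of topological groups (proof-only; abc-iut cell, sub-DAG [AbsTopIII] Prop 3.2 (i)(iv), row P32.iv.L17-TG)

S. Mochizuki, *Topics in Absolute Anabelian Geometry III*, §3, Prop. 3.2 (iv) p. 72 l.26–28: «the categories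
`𝒯𝒢^hyp`, `𝒯𝒢^sB`, `𝒯𝒢^hyp`, `𝒯𝒢^sB` [underlined], `𝒞^{MLF-hyp}_T`, … are id-rigid [cf. §0]», deduced (proof p. 72
l.47–49) «immediately from the slimness of `Π` [cf., e.g., [Mzk20], Proposition 2.3, (ii)]», bib key
`MochizukiAbsTopIII2015`.  This file proves the clause for abc-iut-L4-t9's MODEL of the double-underlined `𝒯𝔾`
(topological groups and isomorphisms of topological groups, `AbsTopIII.MLFGaloisModelCategories.TopGroupObj`,
Def. 3.1 (iii) p. 68), cut out by any hypothesis predicate `H` («hyp», «sB») under which `Π` has trivial centre —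
in particular under which `Π` is slim (`IsSlimGroup`):

* `isIdRigid_topGroupSubcat_of_center_eq_bot` — a natural automorphism `α` of the identity functor is natural
  with respect to `conj_g`, so `g⁻¹ · α_Π(g)` is central in `Π`; with `Z(Π) = 1` this forces `α_Π = id`
  (abc-iut-L6-t13's argument, over `isIdRigid_of_aut_center_trivial` of `MonoidKummerMapsSub.lean`; conjugation by
  `g` is the morphism `⟨MulAut.conj g⟩` of `𝒯𝔾` — the inner automorphisms, p. 72 l.23–25);
* `isIdRigid_topGroupSubcat_of_isSlimGroup` — the printed form («follows immediately from the slimness of `Π`»).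

HONEST FRAMING: OUR kernel check of a printed deduction over OUR model of Def. 3.1 (iii), modulo the slimness
input; nothing here bears on [IUTchIII] Cor. 3.12, and nothing here asserts that abc is proved or refuted.
-/

namespace Literature.AnabelianGeometry.AbsoluteAnabelian

open _root_.CategoryTheory AbsTopIII

noncomputable section

/-- **Row P32.iv.L17-TG, hypothesis-explicit form**: the full subcategory of the model groupoid `𝒯𝔾`
(topological groups, isomorphisms) cut out by a predicate `H` under which every `Π` has trivial centre is
id-rigid (§0): the component `α_Π` of an automorphism `α` of the identity functor is natural with respect to the
inner automorphism `conj_g`, so `α_Π(g x g⁻¹) = g α_Π(x) g⁻¹`, whence `g⁻¹ α_Π(g) ∈ Z(Π) = 1` and `α_Π = id`.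
[cite: MochizukiAbsTopIII2015, Proposition 3.2 (iv) p.72] -/
theorem isIdRigid_topGroupSubcat_of_center_eq_bot {H : TopGroupObj → Prop}
    (hZ : ∀ A : TopGroupObj, H A → Subgroup.center A.G = ⊥) :
    IsIdRigid (ObjectProperty.FullSubcategory H) := by
  refine isIdRigid_of_aut_center_trivial (ObjectProperty.FullSubcategory H) fun X a ha => ?_
  obtain ⟨A, hA⟩ := X
  -- the underlying isomorphism of topological groups
  let φ : A.G ≃ₜ* A.G := ((ObjectProperty.ι _).map a.hom : TopGroupObj.Hom A A).iso
  have hφ : ∀ x, (a.hom.hom : TopGroupObj.Hom A A).iso x = φ x := fun _ => rfl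
  -- naturality with respect to the inner automorphisms
  have hconj : ∀ g x : A.G, φ (g * x * g⁻¹) = g * φ x * g⁻¹ := by
    intro g x
    -- conjugation by `g` as a morphism of `𝒯𝔾` («the inner automorphisms of `Π`», p. 72 l.23–25)
    let c : A ⟶ A :=
      ⟨{ MulAut.conj g with
          continuous_toFun := (continuous_const.mul continuous_id).mul continuous_const
          continuous_invFun := (continuous_const.mul continuous_id).mul continuous_const }⟩
    let b : (⟨A, hA⟩ : ObjectProperty.FullSubcategory H) ≅ ⟨A, hA⟩ :=
      (ObjectProperty.fullyFaithfulι _).preimageIso (TopGroupObj.isoOfHom c)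
    have hab : (a.hom ≫ b.hom).hom = (b.hom ≫ a.hom).hom := congrArg (fun φ => φ.hom) (congrArg Iso.hom (ha b))
    have h := congrArg (fun ψ : TopGroupObj.Hom A A => ψ.iso x) hab
    -- `(a ≫ b)(x) = g φ(x) g⁻¹` and `(b ≫ a)(x) = φ(g x g⁻¹)`
    exact h.symm
  have hid : ∀ g : A.G, φ g = g := by
    intro g
    have hz : g⁻¹ * φ g ∈ Subgroup.center A.G := by
      rw [Subgroup.mem_center_iff]
      intro y
      obtain ⟨h, rfl⟩ := φ.surjective y
      have hc := hconj g h
      rw [map_mul, map_mul, map_inv] at hc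
      calc φ h * (g⁻¹ * φ g)
          = g⁻¹ * (g * φ h * g⁻¹) * φ g := by group
        _ = g⁻¹ * (φ g * φ h * (φ g)⁻¹) * φ g := by rw [hc]
        _ = g⁻¹ * φ g * φ h := by group
    rw [hZ A hA, Subgroup.mem_bot, inv_mul_eq_one] at hz
    exact hz.symm
  exact Iso.ext (ObjectProperty.hom_ext _ (TopGroupObj.Hom.ext fun x => by rw [hφ]; exact hid x))

/-- **Row P32.iv.L17-TG, printed form** («follows immediately from the slimness of `Π`»): if `H` forces `Π` to be
slim (`IsSlimGroup`: centralisers of open subgroups are trivial, in particular `Z(Π) = 1`), the full subcategory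
`𝒯𝔾^H` of the model groupoid of topological groups is id-rigid. [cite: MochizukiAbsTopIII2015, Proposition 3.2 (iv) p.72] -/
theorem isIdRigid_topGroupSubcat_of_isSlimGroup {H : TopGroupObj → Prop}
    (hslim : ∀ A : TopGroupObj, H A → Literature.AlgebraicGeometry.Frobenioids.IsSlimGroup A.G) :
    IsIdRigid (ObjectProperty.FullSubcategory H) := by
  refine isIdRigid_topGroupSubcat_of_center_eq_bot fun A hA => ?_
  have h := (hslim A hA).centralizer_eq_bot ⊤ isOpen_univ
  rw [← h]
  ext z
  simp [Subgroup.mem_center_iff, Subgroup.mem_centralizer_iff, eq_comm]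

end

end Literature.AnabelianGeometry.AbsoluteAnabelian
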